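import Summits.Ventures.HSemireg.WedgeHankelSubstitutionSemisimpleMinpoly
import Summits.Ventures.HSemireg.WedgeHankelClassSpaceIrreducibleCharP

/-!
# Venture HSemireg — THE EIGENSPACES OF A SEMISIMPLE SUBSTITUTION ON TH-7's CLASSES AND THEIR DIMENSIONS: `eigenspace(SbC g, m)` is the span of the eigen-classes of
# weight `m`, of dimension `#{p ≤ n : (α+λ₁γ)^{n−p}(α+λ₂γ)^p = m}`; for a SPLIT TRACE-ZERO `g` (negative scalings `SbC(t 0 0 −t)`, the swap, the quarter turn over a field
# with `√−1`) the two eigenspaces `±s^n` have dimensions `n/2 + 1` and `(n+1)/2`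

HONEST FRAMING. Part of the Lean index of the computation cell `pub-hsemireg` (seat p10 gen 22, Sunday typer «UNIFORM-IN-n»).
Finite-dimensional EXTERIOR ALGEBRA + linear algebra ONLY: no variety, no cohomology theory, no sheaf, no Ext group, no semiregularity map;
nothing here says that HC / HC_CM / HC_AV holds; no Literature fact is declared or used.  Custodian versions as in `WedgeHankelSiegelIdeal` (1/3) and `WedgeHankelFrameChange`;
the dictionary (the class space = `Sym^n` of the letters' plane; a semisimple `g` acts diagonally with the `Sym^n` weights `a^{n−p} b^p`) is QUOTED, never asserted.

WHAT IS IN THE TREE.  J17 `exists_eigenbasis_SbC_of_fixed_two` (two distinct fixed nodes `λ₁ ≠ λ₂` in `K`: an eigenBASIS with weights `(α+λ₁γ)^{n−p}(α+λ₂γ)^p`), J19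
`exists_eigenbasis_SbC_of_upper` / `_diag`, K2 `minpoly_eq_prod_image_of_eigenbasis` (minimal polynomial = product over the DISTINCT weights), K3 `SbC_diag_spikeBasis`, K14
`finrank_ker_SbC_swap_sub_one` / `_add_one` (the swap's `±1` eigenspaces, `n/2 + 1` and `(n+1)/2`, by explicit palindromes), K10/K17 (`hasEigenvalue` for the quarter turn / trace-zero
`g`, no dimensions).  The DIMENSION of an eigenspace was typed only for the swap.  THIS FILE (namespace `Summit.Ventures.HSemireg.Wedge.HankelFrameChange` continued; imports K2, K3):
* §304 GENERALITY for an endomorphism `T` with a basis `b` of eigenvectors (`T (b i) = μ_i • b i`): `apply_eq_sum_of_eigenbasis`, **`repr_apply_of_eigenbasis`** (`repr (T v) i = μ_i · repr v i`),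
  **`mem_eigenspace_iff_of_eigenbasis`** (`T v = m v ⇔ repr v` vanishes off the indices of weight `m`), **`eigenspace_eq_span_of_eigenbasis`: `eigenspace(T, m) = span{b i : μ_i = m}`**,
  **`finrank_eigenspace_of_eigenbasis`: `dim eigenspace(T, m) = #{i : μ_i = m}`**, `hasEigenvalue_iff_of_eigenbasis` (`m` is an eigenvalue iff it is a weight) — every field.
* §305 TH-7's CLASSES: **`finrank_eigenspace_SbC_of_fixed_two`** (`= #{p : (α+λ₁γ)^{n−p}(α+λ₂γ)^p = m}`), `hasEigenvalue_SbC_iff_of_fixed_two`, **`finrank_eigenspace_SbC_of_upper`**,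
  **`eigenspace_SbC_diag_eq_span`** (`eigenspace(SbC(a 0 0 d), m) = span{E_p : a^{n−p}d^p = m}` in th-7's own spikes), `finrank_eigenspace_SbC_diag`, `hasEigenvalue_SbC_diag_iff`.
* §306 SPLIT TRACE-ZERO SUBSTITUTIONS (`2 ≠ 0`): the counts `card_filter_even_fin` (`#{p ≤ n : p even} = n/2 + 1`), `card_filter_odd_fin` (`= (n+1)/2`); `pow_sub_mul_neg_pow`
  (`c^{n−p}(−c)^p = (−1)^p c^n`); **`finrank_eigenspace_SbC_diag_neg_self` / `_neg`** (`SbC(t 0 0 −t)`: `dim E_{t^n} = n/2 + 1`, `dim E_{−t^n} = (n+1)/2`); `weight_eq_neg_of_trace_zero`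
  (a trace-zero `g` has OPPOSITE weights `±s` at two distinct fixed nodes), **`finrank_eigenspace_SbC_trace_zero_self` / `_neg`** (`g = (α β; γ −α)` with fixed nodes `λ₁ ≠ λ₂` in `K`,
  `s = α + λ₁γ ≠ 0`: `dim E_{s^n} = n/2 + 1`, `dim E_{−s^n} = (n+1)/2`), and the quarter turn over a field WITH `i = √−1`: **`finrank_eigenspace_SbC_quarter_of_sq_eq_neg_one`** (`dim E_{i^n}
  = n/2 + 1`, `dim E_{−i^n} = (n+1)/2`, every `n`).
NOT typed here: the quarter turn's `±1` eigenspaces for `n` even over a field WITHOUT `√−1` (next leaf, explicit signed palindromes); non-split semisimple `g` in general; anything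
Ext-side.  New names only.
-/

open Module

namespace Summit.Ventures.HSemireg.Wedge.HankelFrameChange

open Summit.Ventures.HSemireg.Wedge Summit.Ventures.HSemireg.Wedge.Kunneth Summit.Ventures.HSemireg.Wedge.Hankel
  Summit.Ventures.HSemireg.Wedge.BasisFree Summit.Ventures.HSemireg.Wedge.HankelSiegel Summit.Ventures.HSemireg.Wedge.HankelSiegelIdeal
  Summit.Ventures.HSemireg.Wedge.KunnethKernel Summit.Ventures.HSemireg.Wedge.HankelRankOne Summit.Ventures.HSemireg.Wedge.KernelDuality

variable (K : Type*) [Field K] {n : ℕ}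

/-! ## §304. Generality: the eigenspaces of an endomorphism with an eigenbasis -/

section Eigenbasis

variable {V : Type*} [AddCommGroup V] [Module K V] {ι : Type*} [Fintype ι]

/-- `T v = Σ_i (μ_i · repr v i) • b i` when `T (b i) = μ_i • b i`. -/
theorem apply_eq_sum_of_eigenbasis (T : V →ₗ[K] V) (b : Basis ι K V) (μ : ι → K) (hb : ∀ i, T (b i) = μ i • b i) (v : V) :
    T v = ∑ i, (fun i => μ i * b.repr v i) i • b i := by
  conv_lhs => rw [← b.sum_repr v]
  rw [map_sum]
  exact Finset.sum_congr rfl fun i _ => by rw [map_smul, hb i, smul_smul, mul_comm]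

/-- **coordinates: `repr (T v) i = μ_i · repr v i`** — `T` is diagonal in the eigenbasis. -/
theorem repr_apply_of_eigenbasis (T : V →ₗ[K] V) (b : Basis ι K V) (μ : ι → K) (hb : ∀ i, T (b i) = μ i • b i) (v : V) (i : ι) :
    b.repr (T v) i = μ i * b.repr v i := by
  rw [apply_eq_sum_of_eigenbasis K T b μ hb v, Basis.repr_sum_self]

/-- **`v ∈ eigenspace(T, m)` iff its coordinates vanish at every index of weight `≠ m`.** -/
theorem mem_eigenspace_iff_of_eigenbasis (T : V →ₗ[K] V) (b : Basis ι K V) (μ : ι → K) (hb : ∀ i, T (b i) = μ i • b i) (v : V) (m : K) :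
    v ∈ Module.End.eigenspace T m ↔ ∀ i, μ i ≠ m → b.repr v i = 0 := by
  rw [Module.End.mem_eigenspace_iff, ← b.repr.injective.eq_iff, Finsupp.ext_iff]
  refine forall_congr' fun i => ?_
  rw [repr_apply_of_eigenbasis K T b μ hb, map_smul, Finsupp.smul_apply, smul_eq_mul, ← sub_eq_zero, ← sub_mul, mul_eq_zero, sub_eq_zero, or_iff_not_imp_left]

/-- **THE EIGENSPACE OF `m` IS THE SPAN OF THE BASIS VECTORS OF WEIGHT `m`: `eigenspace(T, m) = span{b i : μ_i = m}`** (every field). -/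
theorem eigenspace_eq_span_of_eigenbasis (T : V →ₗ[K] V) (b : Basis ι K V) (μ : ι → K) (hb : ∀ i, T (b i) = μ i • b i) (m : K) :
    Module.End.eigenspace T m = Submodule.span K (Set.range fun i : {i // μ i = m} => b i) := by
  apply le_antisymm
  · intro v hv
    rw [← b.sum_repr v]
    refine Submodule.sum_mem _ fun i _ => ?_
    by_cases e : μ i = m
    · exact Submodule.smul_mem _ _ (Submodule.subset_span ⟨⟨i, e⟩, rfl⟩)
    · rw [(mem_eigenspace_iff_of_eigenbasis K T b μ hb v m).1 hv i e, zero_smul]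
      exact Submodule.zero_mem _
  · rw [Submodule.span_le]
    rintro _ ⟨⟨i, e⟩, rfl⟩
    exact Module.End.mem_eigenspace_iff.mpr (by rw [hb i, e])

/-- **hence `dim eigenspace(T, m) = #{i : μ_i = m}`** (a sub-family of a basis is independent). -/
theorem finrank_eigenspace_of_eigenbasis [DecidableEq K] (T : V →ₗ[K] V) (b : Basis ι K V) (μ : ι → K) (hb : ∀ i, T (b i) = μ i • b i) (m : K) :
    finrank K ↥(Module.End.eigenspace T m) = (Finset.univ.filter fun i => μ i = m).card := by
  have hli : LinearIndependent K fun i : {i // μ i = m} => b i := b.linearIndependent.comp _ Subtype.val_injective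
  rw [eigenspace_eq_span_of_eigenbasis K T b μ hb m, finrank_span_eq_card hli, Fintype.card_subtype]

/-- **`m` is an eigenvalue of `T` iff `m` is one of the weights `μ_i`.** -/
theorem hasEigenvalue_iff_of_eigenbasis (T : V →ₗ[K] V) (b : Basis ι K V) (μ : ι → K) (hb : ∀ i, T (b i) = μ i • b i) (m : K) :
    Module.End.HasEigenvalue T m ↔ ∃ i, μ i = m := by
  constructor
  · intro h
    by_contra hm
    refine Module.End.hasEigenvalue_iff.mp h ?_
    rw [eigenspace_eq_span_of_eigenbasis K T b μ hb m, Submodule.span_eq_bot]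
    rintro _ ⟨⟨i, hi⟩, rfl⟩
    exact absurd ⟨i, hi⟩ hm
  · rintro ⟨i, rfl⟩
    exact Module.End.hasEigenvalue_of_hasEigenvector (Module.End.hasEigenvector_iff.mpr ⟨Module.End.mem_eigenspace_iff.mpr (hb i), b.ne_zero i⟩)

end Eigenbasis

/-! ## §305. The eigenspaces of a semisimple substitution on th-7's classes -/

open Classical in
/-- **TWO DISTINCT FIXED NODES `λ₁ ≠ λ₂` IN `K`: `dim eigenspace(SbC g, m) = #{p ≤ n : (α+λ₁γ)^{n−p}(α+λ₂γ)^p = m}`** (J17's eigenbasis + §304). -/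
theorem finrank_eigenspace_SbC_of_fixed_two {α β γ δ l₁ l₂ : K} (h₁₂ : l₁ ≠ l₂) (e₁ : β + l₁ * δ = l₁ * (α + l₁ * γ)) (e₂ : β + l₂ * δ = l₂ * (α + l₂ * γ)) (m : K) :
    finrank K ↥(Module.End.eigenspace (SbC K α β γ δ (n := n)) m) =
      (Finset.univ.filter fun p : Fin (n + 1) => (α + l₁ * γ) ^ (n - (p : ℕ)) * (α + l₂ * γ) ^ (p : ℕ) = m).card := by
  obtain ⟨b, hb⟩ := exists_eigenbasis_SbC_of_fixed_two K (n := n) h₁₂ e₁ e₂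
  exact finrank_eigenspace_of_eigenbasis K _ b _ hb m

/-- two distinct fixed nodes: `m` is an eigenvalue of `SbC g` iff it is one of the weights `(α+λ₁γ)^{n−p}(α+λ₂γ)^p`. -/
theorem hasEigenvalue_SbC_iff_of_fixed_two {α β γ δ l₁ l₂ : K} (h₁₂ : l₁ ≠ l₂) (e₁ : β + l₁ * δ = l₁ * (α + l₁ * γ)) (e₂ : β + l₂ * δ = l₂ * (α + l₂ * γ)) (m : K) :
    Module.End.HasEigenvalue (SbC K α β γ δ (n := n)) m ↔ ∃ p : Fin (n + 1), (α + l₁ * γ) ^ (n - (p : ℕ)) * (α + l₂ * γ) ^ (p : ℕ) = m := by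
  obtain ⟨b, hb⟩ := exists_eigenbasis_SbC_of_fixed_two K (n := n) h₁₂ e₁ e₂
  exact hasEigenvalue_iff_of_eigenbasis K _ b _ hb m

open Classical in
/-- **AN UPPER SUBSTITUTION WITH A FINITE FIXED NODE (`β + λ₁δ = λ₁α`): `dim eigenspace(SbC(α β 0 δ), m) = #{p ≤ n : α^{n−p}δ^p = m}`** (J19's eigenbasis). -/
theorem finrank_eigenspace_SbC_of_upper {α β δ l₁ : K} (e₁ : β + l₁ * δ = l₁ * α) (m : K) :
    finrank K ↥(Module.End.eigenspace (SbC K α β 0 δ (n := n)) m) = (Finset.univ.filter fun p : Fin (n + 1) => α ^ (n - (p : ℕ)) * δ ^ (p : ℕ) = m).card := by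
  obtain ⟨b, hb⟩ := exists_eigenbasis_SbC_of_upper K (n := n) e₁
  exact finrank_eigenspace_of_eigenbasis K _ b _ hb m

/-- **THE DIAGONAL TORUS IN TH-7's OWN SPIKES: `eigenspace(SbC(a 0 0 d), m) = span{E_p : a^{n−p}d^p = m}`** (K3 `SbC_diag_spikeBasis`). -/
theorem eigenspace_SbC_diag_eq_span (a d m : K) :
    Module.End.eigenspace (SbC K a 0 0 d (n := n)) m =
      Submodule.span K (Set.range fun p : {p : Fin (n + 1) // a ^ (n - (p : ℕ)) * d ^ (p : ℕ) = m} => spikeBasis K n p) :=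
  eigenspace_eq_span_of_eigenbasis K _ (spikeBasis K n) (fun p : Fin (n + 1) => a ^ (n - (p : ℕ)) * d ^ (p : ℕ)) (SbC_diag_spikeBasis K a d) m

open Classical in
/-- `dim eigenspace(SbC(a 0 0 d), m) = #{p ≤ n : a^{n−p}d^p = m}`. -/
theorem finrank_eigenspace_SbC_diag (a d m : K) :
    finrank K ↥(Module.End.eigenspace (SbC K a 0 0 d (n := n)) m) = (Finset.univ.filter fun p : Fin (n + 1) => a ^ (n - (p : ℕ)) * d ^ (p : ℕ) = m).card :=
  finrank_eigenspace_of_eigenbasis K _ (spikeBasis K n) _ (SbC_diag_spikeBasis K a d) m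

/-- `m` is an eigenvalue of `SbC(a 0 0 d)` iff `m = a^{n−p}d^p` for some `p ≤ n`. -/
theorem hasEigenvalue_SbC_diag_iff (a d m : K) :
    Module.End.HasEigenvalue (SbC K a 0 0 d (n := n)) m ↔ ∃ p : Fin (n + 1), a ^ (n - (p : ℕ)) * d ^ (p : ℕ) = m :=
  hasEigenvalue_iff_of_eigenbasis K _ (spikeBasis K n) _ (SbC_diag_spikeBasis K a d) m

/-! ## §306. Split trace-zero substitutions: the two eigenspaces have dimensions `n/2 + 1` and `(n+1)/2` -/

/-- `#{p < N : p even} = (N+1)/2` on `range N`. -/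
theorem card_filter_even_range (N : ℕ) : ((Finset.range N).filter fun p => Even p).card = (N + 1) / 2 := by
  induction N with
  | zero => rfl
  | succ N ih =>
    rw [Finset.range_add_one, Finset.filter_insert]
    by_cases h : Even N
    · rw [if_pos h, Finset.card_insert_of_notMem (by simp), ih]
      obtain ⟨k, rfl⟩ := h
      omega
    · rw [if_neg h, ih]
      rw [Nat.not_even_iff_odd] at h
      obtain ⟨k, rfl⟩ := h
      omega

/-- **`#{p ≤ n : p even} = n/2 + 1`.** -/
theorem card_filter_even_fin : (Finset.univ.filter fun p : Fin (n + 1) => Even (p : ℕ)).card = n / 2 + 1 := by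
  have h : (Finset.univ.filter fun p : Fin (n + 1) => Even (p : ℕ)).map Fin.valEmbedding = (Finset.range (n + 1)).filter fun p => Even p := by
    ext p
    simp only [Finset.mem_map, Finset.mem_filter, Finset.mem_univ, true_and, Fin.valEmbedding_apply, Finset.mem_range]
    constructor
    · rintro ⟨q, hq, rfl⟩; exact ⟨q.2, hq⟩
    · rintro ⟨hp, he⟩; exact ⟨⟨p, hp⟩, he, rfl⟩
  rw [← Finset.card_map Fin.valEmbedding, h, card_filter_even_range]
  omega

/-- **`#{p ≤ n : p odd} = (n+1)/2`.** -/
theorem card_filter_odd_fin : (Finset.univ.filter fun p : Fin (n + 1) => Odd (p : ℕ)).card = (n + 1) / 2 := by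
  have h := Finset.card_filter_add_card_filter_not (s := (Finset.univ : Finset (Fin (n + 1)))) (fun p : Fin (n + 1) => Even (p : ℕ))
  rw [card_filter_even_fin, Finset.card_univ, Fintype.card_fin] at h
  have e : (Finset.univ.filter fun p : Fin (n + 1) => ¬ Even (p : ℕ)) = Finset.univ.filter fun p : Fin (n + 1) => Odd (p : ℕ) :=
    Finset.filter_congr fun p _ => Nat.not_even_iff_odd
  rw [e] at h
  omega

/-- the weights of a split trace-zero substitution: `c^{n−p}(−c)^p = (−1)^p c^n` (`p ≤ n`). -/
theorem pow_sub_mul_neg_pow (c : K) (p : Fin (n + 1)) : c ^ (n - (p : ℕ)) * (-c) ^ (p : ℕ) = (-1) ^ (p : ℕ) * c ^ n := by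
  rw [neg_eq_neg_one_mul, mul_pow, mul_left_comm, ← pow_add, Nat.sub_add_cancel (Nat.le_of_lt_succ p.2)]

/-- `2 ≠ 0`, `m ≠ 0`: `(−1)^p m = m ⇔ p` even. -/
theorem neg_one_pow_mul_eq_self_iff (h2 : (2 : K) ≠ 0) {m : K} (hm : m ≠ 0) (p : ℕ) : (-1 : K) ^ p * m = m ↔ Even p := by
  have h1 : (-1 : K) ≠ 1 := fun h => h2 (by rw [show (2 : K) = 1 - (-1) by ring, h, sub_self])
  rw [mul_eq_right₀ hm, neg_one_pow_eq_one_iff_even h1]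

/-- `2 ≠ 0`, `m ≠ 0`: `(−1)^p m = −m ⇔ p` odd. -/
theorem neg_one_pow_mul_eq_neg_iff (h2 : (2 : K) ≠ 0) {m : K} (hm : m ≠ 0) (p : ℕ) : (-1 : K) ^ p * m = -m ↔ Odd p := by
  have h1 : (-1 : K) ≠ 1 := fun h => h2 (by rw [show (2 : K) = 1 - (-1) by ring, h, sub_self])
  rw [← neg_eq_iff_eq_neg, ← neg_one_mul, ← mul_assoc, ← pow_succ', mul_eq_right₀ hm, neg_one_pow_eq_one_iff_even h1, Nat.even_add_one, Nat.not_even_iff_odd]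

open Classical in
/-- the count at the weight `c^n`: `#{p ≤ n : c^{n−p}(−c)^p = c^n} = n/2 + 1` (`c ≠ 0`, `2 ≠ 0`). -/
theorem card_filter_weight_neg_eq_self (h2 : (2 : K) ≠ 0) {c : K} (hc : c ≠ 0) :
    (Finset.univ.filter fun p : Fin (n + 1) => c ^ (n - (p : ℕ)) * (-c) ^ (p : ℕ) = c ^ n).card = n / 2 + 1 := by
  rw [← card_filter_even_fin (n := n)]
  exact congrArg Finset.card (Finset.filter_congr fun p _ => by rw [pow_sub_mul_neg_pow, neg_one_pow_mul_eq_self_iff K h2 (pow_ne_zero n hc)])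

open Classical in
/-- the count at the weight `−c^n`: `#{p ≤ n : c^{n−p}(−c)^p = −c^n} = (n+1)/2` (`c ≠ 0`, `2 ≠ 0`). -/
theorem card_filter_weight_neg_eq_neg (h2 : (2 : K) ≠ 0) {c : K} (hc : c ≠ 0) :
    (Finset.univ.filter fun p : Fin (n + 1) => c ^ (n - (p : ℕ)) * (-c) ^ (p : ℕ) = -c ^ n).card = (n + 1) / 2 := by
  rw [← card_filter_odd_fin (n := n)]
  exact congrArg Finset.card (Finset.filter_congr fun p _ => by rw [pow_sub_mul_neg_pow, neg_one_pow_mul_eq_neg_iff K h2 (pow_ne_zero n hc)])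

open Classical in
/-- **THE NEGATIVE SCALINGS `SbC(t 0 0 −t)` (`t ≠ 0`, `2 ≠ 0`): `dim eigenspace(t^n) = n/2 + 1`** — the even spikes `E_0, E_2, …`. -/
theorem finrank_eigenspace_SbC_diag_neg_self (h2 : (2 : K) ≠ 0) {t : K} (ht : t ≠ 0) :
    finrank K ↥(Module.End.eigenspace (SbC K t 0 0 (-t) (n := n)) (t ^ n)) = n / 2 + 1 := by
  rw [finrank_eigenspace_SbC_diag, card_filter_weight_neg_eq_self K h2 ht]

open Classical in
/-- **… and `dim eigenspace(−t^n) = (n+1)/2`** — the odd spikes `E_1, E_3, …`. -/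
theorem finrank_eigenspace_SbC_diag_neg_neg (h2 : (2 : K) ≠ 0) {t : K} (ht : t ≠ 0) :
    finrank K ↥(Module.End.eigenspace (SbC K t 0 0 (-t) (n := n)) (-t ^ n)) = (n + 1) / 2 := by
  rw [finrank_eigenspace_SbC_diag, card_filter_weight_neg_eq_neg K h2 ht]

/-- **a TRACE-ZERO `g = (α β; γ −α)` has OPPOSITE weights at two distinct fixed nodes: `α + λ₂γ = −(α + λ₁γ)`** (subtract the two fixed-node equations and cancel `λ₁ − λ₂`). -/
theorem weight_eq_neg_of_trace_zero {α β γ l₁ l₂ : K} (h₁₂ : l₁ ≠ l₂) (e₁ : β + l₁ * -α = l₁ * (α + l₁ * γ)) (e₂ : β + l₂ * -α = l₂ * (α + l₂ * γ)) :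
    α + l₂ * γ = -(α + l₁ * γ) := by
  have h : (l₁ - l₂) * (2 * α + (l₁ + l₂) * γ) = 0 := by linear_combination e₂ - e₁
  have h' : 2 * α + (l₁ + l₂) * γ = 0 := (mul_eq_zero.mp h).resolve_left (sub_ne_zero.mpr h₁₂)
  linear_combination h'

open Classical in
/-- **SPLIT TRACE-ZERO SUBSTITUTIONS: `g = (α β; γ −α)` with fixed nodes `λ₁ ≠ λ₂` in `K`, `s = α + λ₁γ ≠ 0`, `2 ≠ 0` ⇒ `dim eigenspace(SbC g, s^n) = n/2 + 1`** (weights `(−1)^p s^n`). -/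
theorem finrank_eigenspace_SbC_trace_zero_self (h2 : (2 : K) ≠ 0) {α β γ l₁ l₂ : K} (h₁₂ : l₁ ≠ l₂) (e₁ : β + l₁ * -α = l₁ * (α + l₁ * γ)) (e₂ : β + l₂ * -α = l₂ * (α + l₂ * γ))
    (hs : α + l₁ * γ ≠ 0) : finrank K ↥(Module.End.eigenspace (SbC K α β γ (-α) (n := n)) ((α + l₁ * γ) ^ n)) = n / 2 + 1 := by
  rw [finrank_eigenspace_SbC_of_fixed_two K h₁₂ e₁ e₂, ← card_filter_weight_neg_eq_self K (n := n) h2 hs]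
  exact congrArg Finset.card (Finset.filter_congr fun p _ => by rw [weight_eq_neg_of_trace_zero K h₁₂ e₁ e₂])

open Classical in
/-- **… and `dim eigenspace(SbC g, −s^n) = (n+1)/2`.** -/
theorem finrank_eigenspace_SbC_trace_zero_neg (h2 : (2 : K) ≠ 0) {α β γ l₁ l₂ : K} (h₁₂ : l₁ ≠ l₂) (e₁ : β + l₁ * -α = l₁ * (α + l₁ * γ)) (e₂ : β + l₂ * -α = l₂ * (α + l₂ * γ))
    (hs : α + l₁ * γ ≠ 0) : finrank K ↥(Module.End.eigenspace (SbC K α β γ (-α) (n := n)) (-(α + l₁ * γ) ^ n)) = (n + 1) / 2 := by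
  rw [finrank_eigenspace_SbC_of_fixed_two K h₁₂ e₁ e₂, ← card_filter_weight_neg_eq_neg K (n := n) h2 hs]
  exact congrArg Finset.card (Finset.filter_congr fun p _ => by rw [weight_eq_neg_of_trace_zero K h₁₂ e₁ e₂])

open Classical in
/-- **THE QUARTER TURN OVER A FIELD WITH `i`, `i² = −1` (`2 ≠ 0`): `dim eigenspace(SbC(0 −1 1 0), i^n) = n/2 + 1`** — fixed nodes `±i`, weights `(−1)^p i^n`; for `n` even this is the
eigenvalue `(−1)^{n/2}` (K10: the eigenvalues are `±1`), for `n` odd the two eigenspaces `±i^n` have the same dimension `(n+1)/2`. -/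
theorem finrank_eigenspace_SbC_quarter_of_sq_eq_neg_one (h2 : (2 : K) ≠ 0) {i : K} (hi : i ^ 2 = -1) :
    finrank K ↥(Module.End.eigenspace (SbC K 0 (-1) 1 0 (n := n)) (i ^ n)) = n / 2 + 1 := by
  have hi0 : i ≠ 0 := fun h => by rw [h, sq, mul_zero] at hi; exact one_ne_zero (neg_eq_zero.mp hi.symm)
  have h₁₂ : i ≠ -i := fun h => hi0 ((mul_eq_zero.mp (show (2 : K) * i = 0 by rw [two_mul, add_eq_zero_iff_eq_neg]; exact h)).resolve_left h2)
  have e₁ : (-1 : K) + i * -0 = i * (0 + i * 1) := by rw [neg_zero, mul_zero, add_zero, zero_add, mul_one, ← sq, hi]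
  have e₂ : (-1 : K) + -i * -0 = -i * (0 + -i * 1) := by rw [neg_zero, mul_zero, add_zero, zero_add, mul_one, neg_mul_neg, ← sq, hi]
  have hs : (0 : K) + i * 1 ≠ 0 := by rwa [zero_add, mul_one]
  have h := finrank_eigenspace_SbC_trace_zero_self K (n := n) h2 h₁₂ e₁ e₂ hs
  rwa [neg_zero, zero_add, mul_one] at h

open Classical in
/-- **… and `dim eigenspace(SbC(0 −1 1 0), −i^n) = (n+1)/2`.** -/
theorem finrank_eigenspace_SbC_quarter_neg_of_sq_eq_neg_one (h2 : (2 : K) ≠ 0) {i : K} (hi : i ^ 2 = -1) :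
    finrank K ↥(Module.End.eigenspace (SbC K 0 (-1) 1 0 (n := n)) (-i ^ n)) = (n + 1) / 2 := by
  have hi0 : i ≠ 0 := fun h => by rw [h, sq, mul_zero] at hi; exact one_ne_zero (neg_eq_zero.mp hi.symm)
  have h₁₂ : i ≠ -i := fun h => hi0 ((mul_eq_zero.mp (show (2 : K) * i = 0 by rw [two_mul, add_eq_zero_iff_eq_neg]; exact h)).resolve_left h2)
  have e₁ : (-1 : K) + i * -0 = i * (0 + i * 1) := by rw [neg_zero, mul_zero, add_zero, zero_add, mul_one, ← sq, hi]
  have e₂ : (-1 : K) + -i * -0 = -i * (0 + -i * 1) := by rw [neg_zero, mul_zero, add_zero, zero_add, mul_one, neg_mul_neg, ← sq, hi]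
  have hs : (0 : K) + i * 1 ≠ 0 := by rwa [zero_add, mul_one]
  have h := finrank_eigenspace_SbC_trace_zero_neg K (n := n) h2 h₁₂ e₁ e₂ hs
  rwa [neg_zero, zero_add, mul_one] at h

end Summit.Ventures.HSemireg.Wedge.HankelFrameChange
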